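import Literature.Barriers.Schanuel.AlgebraicIndependenceOfLogarithms
import Mathlib.RingTheory.AlgebraicIndependent.TranscendenceBasis
import Mathlib.RingTheory.AlgebraicIndependent.AlgebraicClosure
import Mathlib.FieldTheory.IntermediateField.Adjoin.Algebra
import HarnessLib

/-!
# Transfer of algebraic independence along algebraic extensions

A small tool used by every rank-two sector of this series (`SoloBlindLemniscateSector`,
`SoloBlindEquianharmonic`): if `x, y` are algebraically independent over `ℚ` and some powers
`xʲ, yᵏ` lie in `ℚ(a,b)`, then `a, b` are algebraically independent over `ℚ`
(`algebraicIndependent_pair_of_pow_mem_adjoin`). Proof: `x, y` are algebraic over `K = ℚ(a,b)`, so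
`trdeg_ℚ K = trdeg_ℚ K(x,y) ≥ 2`, and two generators of a field of transcendence degree `≥ 2` are
algebraically independent (`Literature.Barriers.Schanuel.algebraicIndependent_of_le_trdeg_adjoin`).
This is how Chudnovsky's pairs `(π, Γ(1/4))`, `(π, Γ(1/3))` are moved to the periods
`(a, b) = (∫₀¹dx/√(1-x⁴), ∫₀¹x²dx/√(1-x⁴))` and `(B(⅓,⅓), B(⅔,⅔))`.
-/

noncomputable section

namespace Summit.KontsevichZagierPeriods.KontsevichZagierPeriods.Theorems

namespace SoloBlind

/-! ## Transfer of algebraic independence -/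

/-- **Transfer of algebraic independence along an algebraic extension.** If `x, y` are
algebraically independent over `ℚ`, `xʲ ∈ ℚ(a,b)` and `yᵏ ∈ ℚ(a,b)` for some `j, k ≥ 1`, then
`a, b` are algebraically independent over `ℚ` (`trdeg ℚ(a,b) ≥ trdeg ℚ(a,b)(x,y) ≥ 2`). -/
theorem algebraicIndependent_pair_of_pow_mem_adjoin {x y a b : ℝ}
    (h : AlgebraicIndependent ℚ ![x, y]) {j k : ℕ} (hj : 0 < j) (hk : 0 < k)
    (hx : x ^ j ∈ IntermediateField.adjoin ℚ ({a, b} : Set ℝ))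
    (hy : y ^ k ∈ IntermediateField.adjoin ℚ ({a, b} : Set ℝ)) :
    AlgebraicIndependent ℚ ![a, b] := by
  set K : IntermediateField ℚ ℝ := IntermediateField.adjoin ℚ ({a, b} : Set ℝ) with hK
  set A : IntermediateField K ℝ := algebraicClosure K ℝ with hA
  have hKA : ∀ z : ℝ, z ∈ K → z ∈ A := fun z hz => by simpa using A.algebraMap_mem ⟨z, hz⟩
  have hxA : x ∈ A :=
    mem_algebraicClosure_iff.mpr (IsAlgebraic.of_pow hj (mem_algebraicClosure_iff.mp (hKA _ hx)))
  have hyA : y ∈ A :=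
    mem_algebraicClosure_iff.mpr (IsAlgebraic.of_pow hk (mem_algebraicClosure_iff.mp (hKA _ hy)))
  set T : Set ℝ := {x, y} with hT
  have hTalg : ∀ t ∈ T, IsAlgebraic K t := by
    rintro t (rfl | rfl)
    · exact mem_algebraicClosure_iff.mp hxA
    · exact mem_algebraicClosure_iff.mp hyA
  let E : IntermediateField K ℝ := IntermediateField.adjoin K T
  haveI : Algebra.IsAlgebraic K E :=
    IntermediateField.isAlgebraic_adjoin fun t ht => (hTalg t ht).isIntegral
  haveI : FaithfulSMul ℚ K :=
    (faithfulSMul_iff_algebraMap_injective ℚ K).mpr (algebraMap ℚ K).injective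
  haveI : FaithfulSMul K E :=
    (faithfulSMul_iff_algebraMap_injective K E).mpr (algebraMap K E).injective
  have hE : Algebra.trdeg ℚ E = Algebra.trdeg ℚ K := by
    rw [← trdeg_add_eq ℚ K (A := E), trdeg_eq_zero (R := K) (A := E), add_zero]
  have hu : x ∈ E := IntermediateField.subset_adjoin K T (by simp [hT])
  have hv : y ∈ E := IntermediateField.subset_adjoin K T (by simp [hT])
  let g : Fin 2 → E := ![⟨_, hu⟩, ⟨_, hv⟩]
  have hg : AlgebraicIndependent ℚ g := by
    refine AlgebraicIndependent.of_comp (IsScalarTower.toAlgHom ℚ E ℝ) ?_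
    convert h using 1
    ext i
    fin_cases i <;> rfl
  have h2 : (2 : Cardinal) ≤ Algebra.trdeg ℚ K := by
    calc (2 : Cardinal) = Cardinal.mk (Fin 2) := by simp
      _ ≤ Algebra.trdeg ℚ E := hg.cardinalMk_le_trdeg
      _ = Algebra.trdeg ℚ K := hE
  refine Literature.Barriers.Schanuel.algebraicIndependent_of_le_trdeg_adjoin _ ?_
  rw [Matrix.range_cons_cons_empty]
  exact_mod_cast h2

end SoloBlind

end Summit.KontsevichZagierPeriods.KontsevichZagierPeriods.Theorems
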